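import Mathlib
import Summits.Ventures.PercRepro2.HCov
import Summits.Ventures.PercRepro2.BHKOutside
import Summits.Ventures.PercRepro2.BHKAvoid
import Summits.Ventures.PercRepro2.ISplit
import Summits.Ventures.PercRepro2.CrossClusterFunctional
import Summits.Ventures.PercRepro2.FirstOrderTerms
import Summits.Ventures.PercRepro2.FirstOrderSlopeG
import Summits.Ventures.PercRepro2.PendantWKernel
import Summits.Ventures.PercRepro2.PendantW
import Summits.Ventures.PercRepro2.PendantCovMass
import Summits.Ventures.PercRepro2.PendantDmixCov

/-!
# The b-deficit functional of the explored cluster and the fibre lemmas behind `D(β, γ) ≥ 0`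
(blind cell PercRepro2, p5 g23; `proofs/P5-OEDGE.md` §29 addendum 1, `S4-HARDSTEP.md` v98)

Helpers for `PendantDmixThm.lean`: the mass `P(T, b ∈ C₁, o ∈ C₁) = E[m · outsideProb_{b∧o}(C₂)]`
(`mass_TbLoL`), Harris in the fibre `G ∖ C₂` pointwise (`uO_mul_uO_le`), `r · g_x = u_x`
(`rI_mul_delClusterProb`), `m · 1_R = m · r` (`iI_mul_indicator_R`), `delExpect` of an indicator
(`delExpect_indicator_eq'`), and the **b-deficit functional** `defB(K) = 1[a₃ ∈ K]·(β − g_b(K))`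
with its bounds and monotonicity (`defB_nonneg`, `defB_le_beta`, `defB_mono`, `defB_apply`).
-/

namespace Summit.Ventures.PercRepro2

open UnionCluster

namespace CovForm

namespace FirstOrder

section Main

variable {V : Type*} {E : Type*} [Fintype E] [DecidableEq E] [Fintype V] [DecidableEq V]
  {R : Type*} [Field R] [LinearOrder R] [IsStrictOrderedRing R]

omit [LinearOrder R] [IsStrictOrderedRing R] in
/-- `P(T, b ∈ C₁, o ∈ C₁) = E[m · outsideProb_{b ∧ o}(C₂)]`. -/
lemma mass_TbLoL (p : E → R) (ends : E → Sym2 V) (o a₁ a₂ a₃ b : V) :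
    prob p (TEvent ends a₁ a₂ a₃ ∩ connEvent ends a₁ b ∩ connEvent ends a₁ o) =
      expect p (fun ω => iI ends a₂ a₃ ω *
        outsideProb p ends a₁ {W : Set V | b ∈ W ∧ o ∈ W} (cluster ends ω a₂)) := by
  have e : TEvent ends a₁ a₂ a₃ ∩ connEvent ends a₁ b ∩ connEvent ends a₁ o =
      clusterInEvent ends a₂ {W : Set V | a₃ ∈ W} ∩
        clusterInEvent ends a₁ {W : Set V | b ∈ W ∧ o ∈ W} ∩ avoidAll ends a₂ {a₁} := by
    rw [TEvent_eq_explore]; ext ω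
    simp only [Set.mem_inter_iff, mem_clusterInEvent, Set.mem_setOf_eq, mem_cluster, mem_connEvent]
    tauto
  rw [e, prob_explore_C2]; rfl

omit [Fintype V] [DecidableEq V] in
/-- Harris in the fibre `G ∖ C₂`: `u_b · u_o ≤ outsideProb_{b ∧ o}(C₂)` pointwise. -/
lemma uO_mul_uO_le (p : E → R) (hp : IsProbVec p) (ends : E → Sym2 V) (o a₁ a₂ b : V)
    (ω : Config E) :
    uO p ends a₁ a₂ b ω * uO p ends a₁ a₂ o ω ≤
      outsideProb p ends a₁ {W : Set V | b ∈ W ∧ o ∈ W} (cluster ends ω a₂) := by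
  unfold uO
  by_cases h : a₁ ∈ cluster ends ω a₂
  · rw [outsideProb_apply_of_mem p _ h, outsideProb_apply_of_mem p _ h, outsideProb_apply_of_mem p _ h]
    simp
  · rw [outsideProb_apply_of_notMem p _ h, outsideProb_apply_of_notMem p _ h,
      outsideProb_apply_of_notMem p _ h]
    exact delClusterProb_mul_le_inter p hp ends a₁ b o _

omit [Fintype V] [DecidableEq V] [LinearOrder R] [IsStrictOrderedRing R] in
/-- `r · g_x(C₂) = u_x` pointwise (`outsideProb` is the killed `delClusterProb`). -/
lemma rI_mul_delClusterProb (p : E → R) (ends : E → Sym2 V) (a₁ a₂ x : V) (ω : Config E) :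
    rI ends a₁ a₂ ω * delClusterProb p ends a₁ {W : Set V | x ∈ W} (cluster ends ω a₂) =
      uO p ends a₁ a₂ x ω := by
  unfold uO rI
  by_cases h : a₁ ∈ cluster ends ω a₂
  · rw [outsideProb_apply_of_mem p _ h]
    have hnot : ω ∉ avoidAll ends a₂ {a₁} := fun hav =>
      (notMem_cluster_of_mem_avoidAll (Finset.mem_singleton_self a₁) hav) h
    rw [Set.indicator_of_notMem hnot]; simp
  · rw [outsideProb_apply_of_notMem p _ h]
    have hmem : ω ∈ avoidAll ends a₂ {a₁} := by
      intro y hy hc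
      rw [Finset.mem_singleton] at hy; subst hy
      exact h hc
    rw [Set.indicator_of_mem hmem]; simp

omit [Fintype E] [DecidableEq E] [Fintype V] [DecidableEq V] [LinearOrder R] [IsStrictOrderedRing R] in
/-- `r · r = r`. -/
lemma rI_mul_self (ends : E → Sym2 V) (a₁ a₂ : V) (ω : Config E) :
    rI ends a₁ a₂ ω * rI ends a₁ a₂ ω = (rI ends a₁ a₂ ω : R) := by
  rcases rI_zero_or_one (R := R) ends a₁ a₂ ω with h | h <;> rw [h] <;> ring

omit [Fintype E] [DecidableEq E] [Fintype V] [LinearOrder R] [IsStrictOrderedRing R] in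
/-- On `{a₃ ∈ C₂}` the avoidance `R = {a₁ ↮ a₂, a₃}` is `{a₁ ∉ C₂}`: `m · 1_R = m · r`. -/
lemma iI_mul_indicator_R (ends : E → Sym2 V) (a₁ a₂ a₃ : V) (ω : Config E) :
    iI ends a₂ a₃ ω * (avoidAll ends a₁ {a₂, a₃}).indicator (1 : Config E → R) ω =
      iI ends a₂ a₃ ω * rI ends a₁ a₂ ω := by
  unfold iI rI
  by_cases h3 : cluster ends ω a₂ ∈ {W : Set V | a₃ ∈ W}
  · rw [Set.indicator_of_mem h3]
    have h23 : Conn ends ω a₂ a₃ := h3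
    by_cases h12 : Conn ends ω a₁ a₂
    · have hnR : ω ∉ avoidAll ends a₁ {a₂, a₃} := fun hav =>
        hav a₂ (Finset.mem_insert_self a₂ {a₃}) h12
      have hnQ : ω ∉ avoidAll ends a₂ {a₁} := fun hav =>
        hav a₁ (Finset.mem_singleton_self a₁) (conn_symm h12)
      rw [Set.indicator_of_notMem hnR, Set.indicator_of_notMem hnQ]
    · have hR : ω ∈ avoidAll ends a₁ {a₂, a₃} := by
        intro y hy hc
        rw [Finset.mem_insert, Finset.mem_singleton] at hy
        rcases hy with rfl | rfl
        · exact h12 hc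
        · exact h12 (conn_trans hc (conn_symm h23))
      have hQ : ω ∈ avoidAll ends a₂ {a₁} := by
        intro y hy hc
        rw [Finset.mem_singleton] at hy; subst hy
        exact h12 (conn_symm hc)
      rw [Set.indicator_of_mem hR, Set.indicator_of_mem hQ]
  · rw [Set.indicator_of_notMem h3]; simp

omit [Fintype V] [DecidableEq V] [LinearOrder R] [IsStrictOrderedRing R] in
/-- `delExpect` of an indicator functional is `delClusterProb`. -/
lemma delExpect_indicator_eq' (p : E → R) (ends : E → Sym2 V) (t : V) (𝓥 : Set (Set V)) (W : Set V) :
    delExpect p ends (fun t ω => 𝓥.indicator (1 : Set V → R) (cluster ends ω t)) t W =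
      delClusterProb p ends t 𝓥 W := by
  rw [delExpect_clusterFn_apply]
  unfold delClusterProb
  rw [prob_eq_expect_indicator]
  refine congrArg (expect p) (funext fun ω => ?_)
  by_cases h : cluster ends (delConfig ends W ω) t ∈ 𝓥
  · rw [Set.indicator_of_mem h, Set.indicator_of_mem (show ω ∈ {ω | cluster ends (delConfig ends W ω) t ∈ 𝓥} from h)]
    rfl
  · rw [Set.indicator_of_notMem h, Set.indicator_of_notMem (show ω ∉ {ω | cluster ends (delConfig ends W ω) t ∈ 𝓥} from h)]

/-- **The b-deficit functional of the explored cluster**: `F(K) = 1[a₃ ∈ K] · (β − g_b(K))`,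
`g_b(K) = P_{G ∖ K}(b ∈ C₁)`; a monotone functional of `K` with values in `[0, β]`. -/
noncomputable def defB (p : E → R) (ends : E → Sym2 V) (a₁ a₃ b : V) (K : Set V) : R :=
  ({W : Set V | a₃ ∈ W}).indicator 1 K * (beta p ends a₁ b - delClusterProb p ends a₁ {W | b ∈ W} K)

omit [Fintype V] [DecidableEq V] in
/-- `0 ≤ defB` (`g_b(K) ≤ β`). -/
lemma defB_nonneg (p : E → R) (hp : IsProbVec p) (ends : E → Sym2 V) (a₁ a₃ b : V) (K : Set V) :
    0 ≤ defB p ends a₁ a₃ b K :=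
  mul_nonneg (Set.indicator_apply_nonneg fun _ => zero_le_one)
    (sub_nonneg.2 (delClusterProb_le_beta p hp ends a₁ b K))

omit [Fintype V] [DecidableEq V] in
/-- `defB ≤ β`. -/
lemma defB_le_beta (p : E → R) (hp : IsProbVec p) (ends : E → Sym2 V) (a₁ a₃ b : V) (K : Set V) :
    defB p ends a₁ a₃ b K ≤ beta p ends a₁ b := by
  unfold defB
  have h1 : ({W : Set V | a₃ ∈ W}).indicator (1 : Set V → R) K ≤ 1 := by
    by_cases h : K ∈ {W : Set V | a₃ ∈ W}
    · rw [Set.indicator_of_mem h]; exact le_refl _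
    · rw [Set.indicator_of_notMem h]; exact zero_le_one
  have h0 : 0 ≤ ({W : Set V | a₃ ∈ W}).indicator (1 : Set V → R) K :=
    Set.indicator_apply_nonneg fun _ => zero_le_one
  have hg := delClusterProb_nonneg p hp ends a₁ (𝓥 := {W : Set V | b ∈ W}) K
  have hβ := delClusterProb_le_beta p hp ends a₁ b K
  nlinarith [mul_le_mul_of_nonneg_right h1 (sub_nonneg.2 hβ)]

omit [Fintype V] [DecidableEq V] in
/-- `defB` is monotone in `K` (`1_{a₃ ∈ K}` increasing, `g_b` antitone). -/
lemma defB_mono (p : E → R) (hp : IsProbVec p) (ends : E → Sym2 V) (a₁ a₃ b : V) :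
    Monotone (defB p ends a₁ a₃ b) := by
  intro K K' h
  unfold defB
  have hi : ({W : Set V | a₃ ∈ W}).indicator (1 : Set V → R) K ≤
      ({W : Set V | a₃ ∈ W}).indicator 1 K' :=
    monotone_indicator_one_of_isUpperSet (isUpperSet_mem_setOf a₃) h
  have hg : delClusterProb p ends a₁ {W | b ∈ W} K' ≤ delClusterProb p ends a₁ {W | b ∈ W} K :=
    delClusterProb_anti p hp ends a₁ (isUpperSet_mem_setOf b) h
  have h0 : 0 ≤ ({W : Set V | a₃ ∈ W}).indicator (1 : Set V → R) K :=
    Set.indicator_apply_nonneg fun _ => zero_le_one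
  have hβ := delClusterProb_le_beta p hp ends a₁ b K
  exact mul_le_mul hi (by linarith) (by linarith) (Set.indicator_apply_nonneg fun _ => zero_le_one)

omit [Fintype V] [DecidableEq V] [LinearOrder R] [IsStrictOrderedRing R] in
/-- `defB (C₂) = m · (β − g_b(C₂))` pointwise. -/
lemma defB_apply (p : E → R) (ends : E → Sym2 V) (a₁ a₂ a₃ b : V) (ω : Config E) :
    defB p ends a₁ a₃ b (cluster ends ω a₂) =
      iI ends a₂ a₃ ω * (beta p ends a₁ b - delClusterProb p ends a₁ {W | b ∈ W} (cluster ends ω a₂)) :=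
  rfl

omit [Fintype E] [DecidableEq E] [Fintype V] [DecidableEq V] in
/-- `0 ≤ m`. -/
lemma iI_nonneg (ends : E → Sym2 V) (a₂ a₃ : V) (ω : Config E) : (0 : R) ≤ iI ends a₂ a₃ ω := by
  rcases iI_zero_or_one (R := R) ends a₂ a₃ ω with h | h
  · rw [h]
  · rw [h]; exact zero_le_one

end Main

end FirstOrder

end CovForm

end Summit.Ventures.PercRepro2
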